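import Literature.Probability.LatticeModels.FourFunctionsInfiniteProduct
import HarnessLib

/-!
# The four functions theorem on finite and infinite products of 𝔐-EXPANSIVE lattice factors
# (Batty–Bollmann 1980, Thm. 3.7 and Thm. 3.8 in their printed generality, lattice pairing)

CITATION HEADER.  Source: C. J. K. Batty, H. W. Bollmann, *Generalised Holley–Preston inequalities on measure
spaces and their products*, Z. Wahrsch. verw. Gebiete **53** (1980) 157–173 [BattyBollmann1980], p. 163 (3.2):
a paired measure space is "𝔐-expansive if `μ(f₁) μ(f₂) ≤ μ(f₃) μ(f₄)` for all compatible functions `f`";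
p. 166: "Theorem 3.7. The direct product of any finite family of (strongly) 𝔐-expansive paired measure spaces is
(strongly) 𝔐-expansive." and "Theorem 3.8. Let `𝒮` be the direct product of a family `{𝒮_λ : λ ∈ Λ}` of 𝔐-expansive
paired probability spaces. … In particular if each `𝒮_λ` is diagonally invariant and 𝔐-expansive, then `𝒮` is
𝔐-expansive."  The lattice pairing `(∨, ∧)` is diagonally invariant (`x ∨ x = x ∧ x = x`).

`FourFunctionsProductChains.lean` / `FourFunctionsInfiniteProduct.lean` prove these for totally ordered factors
(B–B Prop. 3.4 supplies 𝔐-expansiveness of chains; Cor. 3.9).  This file records the theorems in the paper's actual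
generality for the lattice pairing: the factors are ARBITRARY measurable LATTICES `X i`, each assumed 𝔐-expansive for
its measure `μ i` — the hypothesis `hX` spelled out in every statement (no new definition):
`∀ g₁ g₂ g₃ g₄ : X i → [0,∞]` measurable with `g₁(u) g₂(v) ≤ g₃(u ∨ v) g₄(u ∧ v)` for all `u, v`,
`(∫⁻g₁ dμᵢ)(∫⁻g₂ dμᵢ) ≤ (∫⁻g₃ dμᵢ)(∫⁻g₄ dμᵢ)`.  Examples of 𝔐-expansive factors: every totally ordered measurable
space with an s-finite measure (`expansive_of_linearOrder`, Prop. 3.4), every finite product of 𝔐-expansive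
σ-finite factors (Thm. 3.7 itself, `lintegral_four_functions_pi_of_expansive`), e.g. a finite distributive lattice
with a log-supermodular (FKG) weight (Ahlswede–Daykin); products of such blocks are the typical use.

* `fourFunctions_update_of_expansive`, `fourFunctions_lmarginal_of_expansive` — Lemma 3.6 (everywhere case):
  integrating out one / finitely many 𝔐-expansive coordinates preserves compatibility at every pair.
* `lintegral_four_functions_pi_of_expansive` — **Thm. 3.7**: a finite product (dependent `Measure.pi`, σ-finite
  factors) of 𝔐-expansive lattice factors is 𝔐-expansive.
* `lintegral_four_functions_infinitePi_of_expansive` — **Thm. 3.8 (diagonally invariant case)**: the product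
  `Measure.infinitePi μ` of ANY family of 𝔐-expansive lattice PROBABILITY spaces is 𝔐-expansive; `[0,∞]`-valued
  measurable `fⱼ`, no integrability hypotheses (proof as in `FourFunctionsInfiniteProduct.lean`: fibre inequality for
  `∫⋯∫⁻_s` at every `ω`, almost sure convergence of the head averages `exists_ae_tendsto_lmarginal`, truncation).
* `expansive_of_linearOrder` — chains are 𝔐-expansive (Prop. 3.4, = `lintegral_four_functions_chain`).
-/

noncomputable section

open MeasureTheory Measure Filter Function Set
open scoped ENNReal NNReal Topology

namespace Literature.Probability.LatticeModels.BattyBollmann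

/-! ### Chains are 𝔐-expansive (Prop. 3.4) -/

/-- **[BattyBollmann1980] Prop. 3.4 in the shape of the hypothesis `hX` used below**: a linearly ordered measurable
space with an s-finite measure is 𝔐-expansive for the lattice pairing. [cite: BattyBollmann1980, Prop. 3.4] -/
theorem expansive_of_linearOrder {Y : Type*} [LinearOrder Y] [MeasurableSpace Y] (ν : Measure Y) [SFinite ν] :
    ∀ g₁ g₂ g₃ g₄ : Y → ℝ≥0∞, Measurable g₁ → Measurable g₂ → Measurable g₃ → Measurable g₄ →
      (∀ u v, g₁ u * g₂ v ≤ g₃ (u ⊔ v) * g₄ (u ⊓ v)) →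
        (∫⁻ u, g₁ u ∂ν) * (∫⁻ u, g₂ u ∂ν) ≤ (∫⁻ u, g₃ u ∂ν) * (∫⁻ u, g₄ u ∂ν) :=
  fun _ _ _ _ h₁ h₂ h₃ h₄ h => lintegral_four_functions_chain ν h₁ h₂ h₃ h₄ h

/-! ### The marginal step (Lemma 3.6) for 𝔐-expansive lattice factors -/

section Marginal

variable {ι : Type*} {X : ι → Type*} [∀ i, MeasurableSpace (X i)] [∀ i, Lattice (X i)]
  [DecidableEq ι] (μ : ∀ i, Measure (X i))

omit [∀ i, MeasurableSpace (X i)] in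
/-- Coordinatewise `⊔` and `Function.update` (two base points, lattice factors). [folklore] -/
private theorem update_sup_update' (x y : Π i, X i) (i : ι) (a b : X i) :
    update x i a ⊔ update y i b = update (x ⊔ y) i (a ⊔ b) := by
  funext j
  by_cases hj : j = i
  · subst hj; simp
  · simp [hj]

omit [∀ i, MeasurableSpace (X i)] in
/-- Coordinatewise `⊓` and `Function.update` (two base points, lattice factors). [folklore] -/
private theorem update_inf_update' (x y : Π i, X i) (i : ι) (a b : X i) :
    update x i a ⊓ update y i b = update (x ⊓ y) i (a ⊓ b) := by
  funext j
  by_cases hj : j = i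
  · subst hj; simp
  · simp [hj]

omit [∀ i, Lattice (X i)] in
/-- The one-coordinate marginal of a measurable `f` is measurable. [folklore] -/
private theorem measurable_lintegral_update' [∀ i, SFinite (μ i)] {f : (Π i, X i) → ℝ≥0∞} (hf : Measurable f)
    (i : ι) : Measurable fun x : Π i, X i => ∫⁻ t, f (update x i t) ∂μ i :=
  (hf.comp measurable_update').lintegral_prod_right'

/-- **[BattyBollmann1980] Lemma 3.6 (everywhere case), one 𝔐-expansive coordinate**: integrating out a coordinate
`i` whose factor `(X i, μ i)` is 𝔐-expansive preserves compatibility at every pair. [cite: BattyBollmann1980, Lemma 3.6] -/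
theorem fourFunctions_update_of_expansive [∀ i, SFinite (μ i)]
    (hX : ∀ i, ∀ g₁ g₂ g₃ g₄ : X i → ℝ≥0∞, Measurable g₁ → Measurable g₂ → Measurable g₃ → Measurable g₄ →
      (∀ u v, g₁ u * g₂ v ≤ g₃ (u ⊔ v) * g₄ (u ⊓ v)) →
        (∫⁻ u, g₁ u ∂μ i) * (∫⁻ u, g₂ u ∂μ i) ≤ (∫⁻ u, g₃ u ∂μ i) * (∫⁻ u, g₄ u ∂μ i))
    {f₁ f₂ f₃ f₄ : (Π i, X i) → ℝ≥0∞}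
    (hm₁ : Measurable f₁) (hm₂ : Measurable f₂) (hm₃ : Measurable f₃) (hm₄ : Measurable f₄)
    (h : ∀ x y, f₁ x * f₂ y ≤ f₃ (x ⊔ y) * f₄ (x ⊓ y)) (i : ι) (x y : Π i, X i) :
    (∫⁻ t, f₁ (update x i t) ∂μ i) * (∫⁻ t, f₂ (update y i t) ∂μ i) ≤
      (∫⁻ t, f₃ (update (x ⊔ y) i t) ∂μ i) * (∫⁻ t, f₄ (update (x ⊓ y) i t) ∂μ i) :=
  hX i _ _ _ _ (hm₁.comp (measurable_update x)) (hm₂.comp (measurable_update y))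
    (hm₃.comp (measurable_update _)) (hm₄.comp (measurable_update _)) fun t t' => by
      have := h (update x i t) (update y i t')
      rwa [update_sup_update', update_inf_update'] at this

/-- **[BattyBollmann1980] Lemma 3.6 (everywhere case), finitely many 𝔐-expansive coordinates** (`∫⋯∫⁻_s`, σ-finite
factors, any index set). [cite: BattyBollmann1980, Lemma 3.6] -/
theorem fourFunctions_lmarginal_of_expansive [∀ i, SigmaFinite (μ i)]
    (hX : ∀ i, ∀ g₁ g₂ g₃ g₄ : X i → ℝ≥0∞, Measurable g₁ → Measurable g₂ → Measurable g₃ → Measurable g₄ →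
      (∀ u v, g₁ u * g₂ v ≤ g₃ (u ⊔ v) * g₄ (u ⊓ v)) →
        (∫⁻ u, g₁ u ∂μ i) * (∫⁻ u, g₂ u ∂μ i) ≤ (∫⁻ u, g₃ u ∂μ i) * (∫⁻ u, g₄ u ∂μ i))
    (s : Finset ι) :
    ∀ {f₁ f₂ f₃ f₄ : (Π i, X i) → ℝ≥0∞}, Measurable f₁ → Measurable f₂ → Measurable f₃ → Measurable f₄ →
      (∀ x y, f₁ x * f₂ y ≤ f₃ (x ⊔ y) * f₄ (x ⊓ y)) →
        ∀ x y, (∫⋯∫⁻_s, f₁ ∂μ) x * (∫⋯∫⁻_s, f₂ ∂μ) y ≤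
          (∫⋯∫⁻_s, f₃ ∂μ) (x ⊔ y) * (∫⋯∫⁻_s, f₄ ∂μ) (x ⊓ y) := by
  induction s using Finset.induction_on with
  | empty =>
    intro f₁ f₂ f₃ f₄ _ _ _ _ h x y
    simpa only [lmarginal_empty] using h x y
  | insert i s hi ih =>
    intro f₁ f₂ f₃ f₄ hm₁ hm₂ hm₃ hm₄ h x y
    rw [lmarginal_insert' _ hm₁ hi, lmarginal_insert' _ hm₂ hi, lmarginal_insert' _ hm₃ hi,
      lmarginal_insert' _ hm₄ hi]
    exact ih (measurable_lintegral_update' μ hm₁ i) (measurable_lintegral_update' μ hm₂ i)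
      (measurable_lintegral_update' μ hm₃ i) (measurable_lintegral_update' μ hm₄ i)
      (fourFunctions_update_of_expansive μ hX hm₁ hm₂ hm₃ hm₄ h i) x y

end Marginal

/-! ### Thm. 3.7: finite products of 𝔐-expansive lattice factors -/

section Finite

variable {ι : Type*} [Fintype ι] {X : ι → Type*} [∀ i, MeasurableSpace (X i)] [∀ i, Lattice (X i)]
  (μ : ∀ i, Measure (X i)) [∀ i, SigmaFinite (μ i)]

/-- **[BattyBollmann1980] Thm. 3.7 (everywhere case) for the lattice pairing: a finite product of 𝔐-expansive
σ-finite lattice factors is 𝔐-expansive.** [cite: BattyBollmann1980, Thm. 3.7] -/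
theorem lintegral_four_functions_pi_of_expansive
    (hX : ∀ i, ∀ g₁ g₂ g₃ g₄ : X i → ℝ≥0∞, Measurable g₁ → Measurable g₂ → Measurable g₃ → Measurable g₄ →
      (∀ u v, g₁ u * g₂ v ≤ g₃ (u ⊔ v) * g₄ (u ⊓ v)) →
        (∫⁻ u, g₁ u ∂μ i) * (∫⁻ u, g₂ u ∂μ i) ≤ (∫⁻ u, g₃ u ∂μ i) * (∫⁻ u, g₄ u ∂μ i))
    {f₁ f₂ f₃ f₄ : (Π i, X i) → ℝ≥0∞} (hm₁ : Measurable f₁)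
    (hm₂ : Measurable f₂) (hm₃ : Measurable f₃) (hm₄ : Measurable f₄)
    (h : ∀ x y, f₁ x * f₂ y ≤ f₃ (x ⊔ y) * f₄ (x ⊓ y)) :
    (∫⁻ x, f₁ x ∂Measure.pi μ) * (∫⁻ x, f₂ x ∂Measure.pi μ) ≤
      (∫⁻ x, f₃ x ∂Measure.pi μ) * (∫⁻ x, f₄ x ∂Measure.pi μ) := by
  classical
  rcases isEmpty_or_nonempty (Π i, X i) with he | ⟨⟨x⟩⟩
  · simp [Measure.eq_zero_of_isEmpty (Measure.pi μ)]
  · have key := fourFunctions_lmarginal_of_expansive μ hX Finset.univ hm₁ hm₂ hm₃ hm₄ h x x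
    simp only [sup_idem, inf_idem] at key
    simpa only [lintegral_eq_lmarginal_univ x] using key

end Finite

/-! ### Thm. 3.8: infinite products of 𝔐-expansive lattice probability spaces -/

section Infinite

variable {ι : Type*} {X : ι → Type*} [∀ i, MeasurableSpace (X i)] [∀ i, Lattice (X i)]
  (μ : (i : ι) → Measure (X i)) [hμ : ∀ i, IsProbabilityMeasure (μ i)]

/-- **[BattyBollmann1980] Thm. 3.8 (lattice pairing), all four integrals finite.**  (Pick one `ω` at which
the four `lmarginal`s over `s m ↑` converge to the four integrals; the fibre inequality
`H f₁(ω) H f₂(ω) ≤ H f₃(ω) H f₄(ω)` holds at every `ω` by Lemma 3.6; pass to the limit.)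
[cite: BattyBollmann1980, Thm. 3.8] -/
theorem lintegral_four_functions_infinitePi_of_expansive_of_ne_top
    (hX : ∀ i, ∀ g₁ g₂ g₃ g₄ : X i → ℝ≥0∞, Measurable g₁ → Measurable g₂ → Measurable g₃ → Measurable g₄ →
      (∀ u v, g₁ u * g₂ v ≤ g₃ (u ⊔ v) * g₄ (u ⊓ v)) →
        (∫⁻ u, g₁ u ∂μ i) * (∫⁻ u, g₂ u ∂μ i) ≤ (∫⁻ u, g₃ u ∂μ i) * (∫⁻ u, g₄ u ∂μ i))
    {f₁ f₂ f₃ f₄ : (Π i, X i) → ℝ≥0∞}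
    (hm₁ : Measurable f₁) (hm₂ : Measurable f₂) (hm₃ : Measurable f₃) (hm₄ : Measurable f₄)
    (h : ∀ x y, f₁ x * f₂ y ≤ f₃ (x ⊔ y) * f₄ (x ⊓ y)) (h₁ : ∫⁻ x, f₁ x ∂infinitePi μ ≠ ∞)
    (h₂ : ∫⁻ x, f₂ x ∂infinitePi μ ≠ ∞) (h₃ : ∫⁻ x, f₃ x ∂infinitePi μ ≠ ∞)
    (h₄ : ∫⁻ x, f₄ x ∂infinitePi μ ≠ ∞) :
    (∫⁻ x, f₁ x ∂infinitePi μ) * (∫⁻ x, f₂ x ∂infinitePi μ) ≤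
      (∫⁻ x, f₃ x ∂infinitePi μ) * (∫⁻ x, f₄ x ∂infinitePi μ) := by
  classical
  obtain ⟨t₁, ht₁⟩ := exists_ae_tendsto_lmarginal μ hm₁ h₁
  obtain ⟨t₂, ht₂⟩ := exists_ae_tendsto_lmarginal μ hm₂ h₂
  obtain ⟨t₃, ht₃⟩ := exists_ae_tendsto_lmarginal μ hm₃ h₃
  obtain ⟨t₄, ht₄⟩ := exists_ae_tendsto_lmarginal μ hm₄ h₄
  set s : ℕ → Finset ι := fun m => t₁ m ∪ t₂ m ∪ t₃ m ∪ t₄ m with hs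
  have T₁ := ht₁ s fun m x hx => by simp [hs, hx]
  have T₂ := ht₂ s fun m x hx => by simp [hs, hx]
  have T₃ := ht₃ s fun m x hx => by simp [hs, hx]
  have T₄ := ht₄ s fun m x hx => by simp [hs, hx]
  obtain ⟨ω, hω₁, hω₂, hω₃, hω₄⟩ := (T₁.and (T₂.and (T₃.and T₄))).exists
  have fib : ∀ m, (∫⋯∫⁻_(s m), f₁ ∂μ) ω * (∫⋯∫⁻_(s m), f₂ ∂μ) ω ≤
      (∫⋯∫⁻_(s m), f₃ ∂μ) ω * (∫⋯∫⁻_(s m), f₄ ∂μ) ω := fun m => by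
    simpa only [sup_idem, inf_idem] using fourFunctions_lmarginal_of_expansive μ hX (s m) hm₁ hm₂ hm₃ hm₄ h ω ω
  exact le_of_tendsto_of_tendsto' (ENNReal.Tendsto.mul hω₁ (Or.inr h₂) hω₂ (Or.inr h₁))
    (ENNReal.Tendsto.mul hω₃ (Or.inr h₄) hω₄ (Or.inr h₃)) fib

omit hμ in
/-- Monotone truncation recovers the integral: `⨆_K ∫⁻ (f ∧ K) = ∫⁻ f`. [folklore] -/
private theorem iSup_lintegral_min_natCast {α : Type*} [MeasurableSpace α] (ν : Measure α) {f : α → ℝ≥0∞}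
    (hf : Measurable f) : ⨆ K : ℕ, ∫⁻ x, min (f x) K ∂ν = ∫⁻ x, f x ∂ν := by
  rw [← lintegral_iSup (fun K => hf.min measurable_const)
    (fun K L hKL x => min_le_min_left _ (Nat.cast_le.2 hKL))]
  refine lintegral_congr fun x => le_antisymm (iSup_le fun K => min_le_left _ _) ?_
  rcases eq_or_ne (f x) ∞ with hx | hx
  · rw [hx]
    simp only [min_eq_right le_top, ENNReal.iSup_natCast, le_refl]
  · obtain ⟨K, hK⟩ := ENNReal.exists_nat_gt hx
    exact le_iSup_of_le K (le_min le_rfl hK.le)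

omit hμ in
/-- Products of monotone suprema are bounded termwise. [folklore] -/
private theorem iSup_mul_iSup_le_of_monotone {a b : ℕ → ℝ≥0∞} (ha : Monotone a) (hb : Monotone b) {C : ℝ≥0∞}
    (h : ∀ K, a K * b K ≤ C) : (⨆ K, a K) * (⨆ K, b K) ≤ C := by
  rw [ENNReal.iSup_mul]
  refine iSup_le fun K => ?_
  rw [ENNReal.mul_iSup]
  refine iSup_le fun L => ?_
  exact (mul_le_mul' (ha (le_max_left K L)) (hb (le_max_right K L))).trans (h (max K L))

/-- **[BattyBollmann1980] Theorem 3.8 (diagonally invariant case) for the lattice pairing: THE FOUR FUNCTIONS THEOREM ON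
AN INFINITE PRODUCT OF 𝔐-EXPANSIVE LATTICE PROBABILITY SPACES.**  Let `μ i` (`i : ι`, ANY index set) be probability
measures on measurable lattices `X i`, each 𝔐-expansive (`hX`), `μ∞ = ⊗ᵢ μᵢ` (`Measure.infinitePi`), and let
`f₁, f₂, f₃, f₄ : (Π i, X i) → [0,∞]` be measurable with `f₁(x) f₂(y) ≤ f₃(x ∨ y) f₄(x ∧ y)` for ALL `x, y`.  Then
`(∫⁻ f₁ dμ∞)(∫⁻ f₂ dμ∞) ≤ (∫⁻ f₃ dμ∞)(∫⁻ f₄ dμ∞)` (no integrability hypotheses).  The chain case is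
`lintegral_four_functions_infinitePi` (Cor. 3.9). [cite: BattyBollmann1980, Thm. 3.8] -/
theorem lintegral_four_functions_infinitePi_of_expansive
    (hX : ∀ i, ∀ g₁ g₂ g₃ g₄ : X i → ℝ≥0∞, Measurable g₁ → Measurable g₂ → Measurable g₃ → Measurable g₄ →
      (∀ u v, g₁ u * g₂ v ≤ g₃ (u ⊔ v) * g₄ (u ⊓ v)) →
        (∫⁻ u, g₁ u ∂μ i) * (∫⁻ u, g₂ u ∂μ i) ≤ (∫⁻ u, g₃ u ∂μ i) * (∫⁻ u, g₄ u ∂μ i))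
    {f₁ f₂ f₃ f₄ : (Π i, X i) → ℝ≥0∞}
    (hm₁ : Measurable f₁) (hm₂ : Measurable f₂) (hm₃ : Measurable f₃) (hm₄ : Measurable f₄)
    (h : ∀ x y, f₁ x * f₂ y ≤ f₃ (x ⊔ y) * f₄ (x ⊓ y)) :
    (∫⁻ x, f₁ x ∂infinitePi μ) * (∫⁻ x, f₂ x ∂infinitePi μ) ≤
      (∫⁻ x, f₃ x ∂infinitePi μ) * (∫⁻ x, f₄ x ∂infinitePi μ) := by
  set P := infinitePi μ with hP
  -- truncations of `f₁, f₂`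
  set t₁ : ℕ → (Π i, X i) → ℝ≥0∞ := fun K x => min (f₁ x) K with ht₁
  set t₂ : ℕ → (Π i, X i) → ℝ≥0∞ := fun K x => min (f₂ x) K with ht₂
  have mt₁ : ∀ K, Measurable (t₁ K) := fun K => hm₁.min measurable_const
  have mt₂ : ∀ K, Measurable (t₂ K) := fun K => hm₂.min measurable_const
  have fin_t : ∀ {f : (Π i, X i) → ℝ≥0∞} (K : ℕ), ∫⁻ x, min (f x) K ∂P ≠ ∞ := fun {f} K => by
    refine ne_top_of_le_ne_top (b := ∫⁻ _, (K : ℝ≥0∞) ∂P) ?_ (lintegral_mono fun x => min_le_right _ _)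
    rw [lintegral_const, measure_univ, mul_one]
    exact ENNReal.natCast_ne_top K
  have le_t : ∀ {f : (Π i, X i) → ℝ≥0∞} (K : ℕ) (x), min (f x) K ≤ (K : ℝ≥0∞) := fun K x => min_le_right _ _
  -- the truncated quadruple is compatible
  have hc : ∀ K x y, t₁ K x * t₂ K y ≤ f₃ (x ⊔ y) * f₄ (x ⊓ y) := fun K x y =>
    (mul_le_mul' (min_le_left _ _) (min_le_left _ _)).trans (h x y)
  -- a nonzero product on the left forces nonzero `f₃ (x ⊔ y)` and `f₄ (x ⊓ y)`
  have hnz : ∀ K x y, t₁ K x * t₂ K y ≠ 0 → f₃ (x ⊔ y) ≠ 0 ∧ f₄ (x ⊓ y) ≠ 0 := fun K x y h0 => by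
    have hpos : 0 < f₃ (x ⊔ y) * f₄ (x ⊓ y) := (pos_iff_ne_zero.2 h0).trans_le (hc K x y)
    exact ⟨left_ne_zero_of_mul hpos.ne', right_ne_zero_of_mul hpos.ne'⟩
  have key : ∀ K : ℕ, (∫⁻ x, t₁ K x ∂P) * (∫⁻ x, t₂ K x ∂P) ≤ (∫⁻ x, f₃ x ∂P) * (∫⁻ x, f₄ x ∂P) := by
    intro K
    by_cases h₃ : ∫⁻ x, f₃ x ∂P = ∞
    · by_cases h₄0 : ∫⁻ x, f₄ x ∂P = 0
      · -- degenerate case `∫ f₃ = ∞`, `∫ f₄ = 0`: the left side vanishes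
        set N := {x | f₄ x ≠ 0} with hN
        have mN : MeasurableSet N := hm₄ (measurableSet_singleton 0).compl
        have hN0 : P N = 0 := by
          have := (lintegral_eq_zero_iff hm₄).1 h₄0
          rw [Filter.EventuallyEq, ae_iff] at this
          simpa [hN] using this
        set g₄ : (Π i, X i) → ℝ≥0∞ := N.indicator fun _ => (K : ℝ≥0∞) * K with hg₄
        have mg₄ : Measurable g₄ := measurable_const.indicator mN
        have ig₄ : ∫⁻ x, g₄ x ∂P = 0 := by
          rw [hg₄, lintegral_indicator mN, setLIntegral_const, hN0, mul_zero]
        have hcK : ∀ x y, t₁ K x * t₂ K y ≤ (1 : ℝ≥0∞) * g₄ (x ⊓ y) := fun x y => by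
          by_cases h0 : t₁ K x * t₂ K y = 0
          · rw [h0]; exact zero_le
          · rw [hg₄, Set.indicator_of_mem (show x ⊓ y ∈ N from (hnz K x y h0).2), one_mul]
            exact mul_le_mul' (le_t K x) (le_t K y)
        have AD := lintegral_four_functions_infinitePi_of_expansive_of_ne_top μ hX (mt₁ K) (mt₂ K) measurable_const mg₄ hcK
          (fin_t K) (fin_t K) (by simp) (by rw [ig₄]; exact ENNReal.zero_ne_top)
        rw [ig₄, mul_zero] at AD
        exact AD.trans zero_le
      · rw [h₃, ENNReal.top_mul h₄0]; exact le_top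
    by_cases h₄ : ∫⁻ x, f₄ x ∂P = ∞
    · by_cases h₃0 : ∫⁻ x, f₃ x ∂P = 0
      · -- degenerate case `∫ f₄ = ∞`, `∫ f₃ = 0`
        set N := {x | f₃ x ≠ 0} with hN
        have mN : MeasurableSet N := hm₃ (measurableSet_singleton 0).compl
        have hN0 : P N = 0 := by
          have := (lintegral_eq_zero_iff hm₃).1 h₃0
          rw [Filter.EventuallyEq, ae_iff] at this
          simpa [hN] using this
        set g₃ : (Π i, X i) → ℝ≥0∞ := N.indicator fun _ => (K : ℝ≥0∞) * K with hg₃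
        have mg₃ : Measurable g₃ := measurable_const.indicator mN
        have ig₃ : ∫⁻ x, g₃ x ∂P = 0 := by
          rw [hg₃, lintegral_indicator mN, setLIntegral_const, hN0, mul_zero]
        have hcK : ∀ x y, t₁ K x * t₂ K y ≤ g₃ (x ⊔ y) * (1 : ℝ≥0∞) := fun x y => by
          by_cases h0 : t₁ K x * t₂ K y = 0
          · rw [h0]; exact zero_le
          · rw [hg₃, Set.indicator_of_mem (show x ⊔ y ∈ N from (hnz K x y h0).1), mul_one]
            exact mul_le_mul' (le_t K x) (le_t K y)
        have AD := lintegral_four_functions_infinitePi_of_expansive_of_ne_top μ hX (mt₁ K) (mt₂ K) mg₃ measurable_const hcK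
          (fin_t K) (fin_t K) (by rw [ig₃]; exact ENNReal.zero_ne_top) (by simp)
        rw [ig₃, zero_mul] at AD
        exact AD.trans zero_le
      · rw [h₄, ENNReal.mul_top h₃0]; exact le_top
    exact lintegral_four_functions_infinitePi_of_expansive_of_ne_top μ hX (mt₁ K) (mt₂ K) hm₃ hm₄ (hc K) (fin_t K) (fin_t K)
      h₃ h₄
  -- monotone convergence in `K`
  have mono : ∀ {f : (Π i, X i) → ℝ≥0∞}, Monotone fun K : ℕ => ∫⁻ x, min (f x) K ∂P :=
    fun {f} K L hKL => lintegral_mono fun x => min_le_min_left _ (Nat.cast_le.2 hKL)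
  rw [← iSup_lintegral_min_natCast P hm₁, ← iSup_lintegral_min_natCast P hm₂]
  exact iSup_mul_iSup_le_of_monotone mono mono key


end Infinite

end Literature.Probability.LatticeModels.BattyBollmann
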